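import Summits.CriticalPhenomena.PercolationContinuityZ3.Theorems.Transplant.SkelNeg1RootGlueTA
import Summits.CriticalPhenomena.PercolationContinuityZ3.Theorems.Transplant.SkelNeg1RootHoldsXEA
import Summits.CriticalPhenomena.PercolationContinuityZ3.Theorems.Transplant.SkelNeg1RootHoldsYE
import Summits.CriticalPhenomena.PercolationContinuityZ3.Theorems.Transplant.SkelNegBParamsResidualsA
import HarnessLib

/-!
# N1 (the `{±1}` node), (R) column under (ζ′) + the L closure: **THE SLOT-ROBUST ROOT WRAPPER** —
# `rootHoldsNOWFnL_negChoiceAllOTA_of_le (gx : Neg.FSlot) (Px : NegB.PSlot) (ex mx : NegB.GSlot) (hML) (hex) :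
#   RootHoldsNOWFnL NegB.LfA (negChoiceAllOTA (KS.gT 0 gx) (KS.fT 0 KS.fxA) (KS.PR 0 Px) (SUA ex mx))`
# for ANY box slot `gx` meeting the two `M_L` floors pointwise (`hML : 22000·Kq·(RA′+2) ≤ M_L ∧ 64·(n_b + ℓ_b + |h_b|) ≤ M_L` at `g := KS.gT 0 gx`) and
# ANY residual slot `ex` with `exA ≤ ex` pointwise (`hex`) — so that NO further slot-ledger re-version (v2 `exAF c`, v3 `gxAK/exAFK` with the κ-dependent
# bridge index `cK κ`, lead 2026-08-22T09:18:25Z / design-owner ruling 09:38:09Z, …) ever needs a new (R) proof: each is the one-liner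
# `…_of_le <gx> <Px> <ex> <mx> (fun κ … D => ⟨(KS.ML_floorsA …).1-weakened, (KS.ML_floorsA …).2.1⟩) (fun κ … D => (exAF_eq …).2)`
# (the v2 wrapper `rootHoldsNOWFnL_negChoiceAllOTA_F` of SkelNeg1RootHoldsAF is exactly this instance at `gx := gxA c`, `ex := exAF c` — not restated here).
# Ingredients: the ex-generic families `NegB.rootOblTWAt_negBTA_x_ex` (SkelNeg1RootHoldsXEA) / `NegB.rootOblTWAt_negBTA_y_ex` (SkelNeg1RootHoldsYE),
# the nine (R) floors and the `×Kq` run floor TRANSPORTED from `exA` along `hex` (`floors_of_exA_le`, `floorsK_of_exA_le`, this file), the `n_L` floor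
# `KS.nL_floorsA.1` at `fx := KS.fxA` (any g), glued by `rootHoldsNOWFnL_negChoiceAllOTA_of_xy` (SkelNeg1RootGlueTA).  (Same pattern as p5-g12's
# slot-robust (C) `reachHoldsRHNOFnL_negChoiceAllOTA_of_exA_le`, p324720.)

builds on p205010 (kernel theorem, internal audit signed; external expert review pending) — nothing here uses it; NOTHING is claimed about the open node
`SamePDropOfSkeletonNeg₁`: this is ONE of the four hypotheses of `samePDropOfSkeletonNeg₁_of_choiceFnNOWL NegB.LfA (negChoiceAllOTA …)`.
Lane `prim-bschramm`, seat `prim-bschramm-p3` (gen 12; design owner + (R) owner); helper file (`--supports stmt-CriticalPhenomena-4575 --as helper`).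
[cite: KozmaNitzan2024, §4 p. 28 ((32) at the root)]
-/

noncomputable section

open scoped Classical

namespace Summit.CriticalPhenomena.PercolationContinuityZ3.Theorems.Transplant

open MeasureTheory Literature.Probability.Percolation Literature.Probability.LatticeModels SimpleGraph KNCells KNLevels

namespace PlanarSkeletonNeg

open SkelConc (Consts)
open Skelφ (shearUnit)
open Skelφ.StepI (DataN OutO eventNAt)

namespace NegB

open Neg

section Transport

variable (κ : Consts) {V : Type} [DecidableEq V] [Countable V] {G : SimpleGraph V} [G.LocallyFinite] (Φ : PlanarSkeletonNeg G) (t : V)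
  (p : unitInterval) (D : DataN V) (g f : ℕ)

/-- **The nine (R) floors transported from `exA` to any `e ≥ exA`.** [folklore] -/
theorem floors_of_exA_le (e : ℕ) (hex : exA κ Φ t p D g f ≤ e) :
    KS.r₀A Φ t D 0 (Rb κ Φ t p D) + 1 ≤ e ∧ KS.r₀A Φ t D 0 (Rl κ Φ t p D g f) + 1 ≤ e ∧
    Rl κ Φ t p D g f + 1 ≤ e ∧ Rb κ Φ t p D + 1 ≤ e ∧
    Yb κ Φ t p D g f + 1000 * shearUnit (nL κ Φ t p D g f) (hL κ Φ t p D g f) + 1 ≤ e ∧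
    exC κ Φ t p D g f ≤ e ∧ KS.RlevA κ Φ t p D 0 + KS.reachA t D 0 ≤ e ∧
    KS.r₀A Φ t D 0 (Rl κ Φ t p D g f) ≤ e ∧ Yb κ Φ t p D g f + 11055 * nL κ Φ t p D g f + 1000 * ℓL κ Φ t p D g f + 20 ≤ e := by
  obtain ⟨h1, h2, h3, h4, h5, h6, h7, h8, h9⟩ := floors_exA κ Φ t p D g f
  exact ⟨h1.trans hex, h2.trans hex, h3.trans hex, h4.trans hex, h5.trans hex, h6.trans hex, h7.trans hex, h8.trans hex, h9.trans hex⟩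

/-- **The `×Kq` run floor transported from `exA` to any `e ≥ exA`.** [folklore] -/
theorem floorsK_of_exA_le (e : ℕ) (hex : exA κ Φ t p D g f ≤ e) :
    Yb κ Φ t p D g f + 1000 * Neg.Kq κ * shearUnit (nL κ Φ t p D g f) (hL κ Φ t p D g f) + 1 ≤ e :=
  (floorsK_exA κ Φ t p D g f).1.trans hex

end Transport

end NegB

set_option maxHeartbeats 1600000 in
/-- **`RootHoldsNOWFnL NegB.LfA` of the (ζ′) choice function for ANY box slot `gx` meeting the `M_L` floors and ANY residual slot `ex ≥ exA`**
(`fx := KS.fxA`; `Px`, `mx` general). [cite: KozmaNitzan2024, §4 p. 28 ((32) at the root)] -/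
theorem rootHoldsNOWFnL_negChoiceAllOTA_of_le (gx : Neg.FSlot) (Px : NegB.PSlot) (ex mx : NegB.GSlot)
    (hML : ∀ (κ : Consts) {V : Type} [DecidableEq V] [Countable V] {G : SimpleGraph V} [G.LocallyFinite] (Φ : PlanarSkeletonNeg G) (t : V)
      (p : unitInterval) (D : DataN V),
      22000 * Neg.Kq κ * (NegB.KS.RA' κ Φ t p D 0 + 2) ≤ NegB.ML κ Φ t p D (NegB.KS.gT 0 gx κ Φ t p D) ∧
        64 * (NegB.KS.nBR κ Φ t p D 0 + NegB.KS.ℓBR κ Φ t p D 0 + (NegB.KS.hBR κ Φ t p D 0).natAbs) ≤ NegB.ML κ Φ t p D (NegB.KS.gT 0 gx κ Φ t p D))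
    (hex : ∀ (κ : Consts) {V : Type} [DecidableEq V] [Countable V] {G : SimpleGraph V} [G.LocallyFinite] (Φ : PlanarSkeletonNeg G) (t : V)
      (p : unitInterval) (D : DataN V),
      NegB.exA κ Φ t p D (NegB.KS.gT 0 gx κ Φ t p D) (NegB.KS.fT 0 NegB.KS.fxA κ Φ t p D) ≤ ex κ Φ t p D (NegB.KS.gT 0 gx κ Φ t p D) (NegB.KS.fT 0 NegB.KS.fxA κ Φ t p D)) :
    RootHoldsNOWFnL NegB.LfA (negChoiceAllOTA (NegB.KS.gT 0 gx) (NegB.KS.fT 0 NegB.KS.fxA) (NegB.KS.PR 0 Px) (NegB.SUA ex mx)) :=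
  rootHoldsNOWFnL_negChoiceAllOTA_of_xy _ _ _ _
    (fun κ _ _ _ _ _ Φ t p _ O _ hAt h1 hp0 hp1 hflat du hd =>
      NegB.rootOblTWAt_negBTA_x_ex gx NegB.KS.fxA Px mx ex hAt h1 hp0 hp1 hflat du hd
        -- `2000·Kq·(RA′+2) ≤ 2400·Kq·(RA′+2) ≤ n_L` at `fx := fxA` (any g)
        (le_trans (Nat.mul_le_mul_right _ (Nat.mul_le_mul_right _ (by norm_num)))
          (NegB.KS.nL_floorsA κ Φ t p O.merged (NegB.KS.gT 0 gx κ Φ t p O.merged)).1)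
        (hML κ Φ t p O.merged).1
        (NegB.floors_of_exA_le κ Φ t p O.merged _ _ _ (hex κ Φ t p O.merged))
        (NegB.floorsK_of_exA_le κ Φ t p O.merged _ _ _ (hex κ Φ t p O.merged)))
    (fun κ _ _ _ _ _ Φ t p _ O _ hAt h1 hp0 hp1 hflat du hd =>
      NegB.rootOblTWAt_negBTA_y_ex gx NegB.KS.fxA Px mx ex hAt h1 hp0 hp1 hflat du hd
        (le_trans (Nat.mul_le_mul_right _ (Nat.mul_le_mul_right _ (by norm_num)))
          (NegB.KS.nL_floorsA κ Φ t p O.merged (NegB.KS.gT 0 gx κ Φ t p O.merged)).1)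
        (hML κ Φ t p O.merged).1 (hML κ Φ t p O.merged).2 (hex κ Φ t p O.merged)
        (NegB.floors_of_exA_le κ Φ t p O.merged _ _ _ (hex κ Φ t p O.merged))
        (NegB.floorsK_of_exA_le κ Φ t p O.merged _ _ _ (hex κ Φ t p O.merged)))

end PlanarSkeletonNeg

end Summit.CriticalPhenomena.PercolationContinuityZ3.Theorems.Transplant

end
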